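import Literature.MathematicalPhysics.QuantumLattice.InfVolFermionStateTorusLimitLocalStability
import Literature.MathematicalPhysics.QuantumLattice.HubbardRingPerronFrobeniusProofs
import Summits.Ventures.CertifiedManyBodySolver.HubbardAlg.GSWindowNodeD4
import HarnessLib

/-!
# GSStabilityRowsSzZero — ground-state stability rows for EVERY number-conserving word (hubbard-alg L2, R2-TW complement)

HONEST FRAMING: first certified bounds; not a superconductivity verdict; every number certified or labelled float.
This file has NO number and NO certificate: it is row SOUNDNESS only.

## What this file adds (op-07 lineage, textual audit of pub-hubbard #237 `GSTermwiseRows`, 2026-08-22)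

The tree's local-stability theorem `InfVolFermionState.IsTorusLimitOf.localStability`
(`Literature/…/InfVolFermionStateTorusLimitLocalStability`) gives the E2-type ground-state row
`ω(Ã⋆[H_{Λ⁺}, Ã]) ≥ 0` for words `A ∈ 𝔄_Λ` that conserve BOTH the local particle number AND the local `S^z`
(`Commute A totalNumber`, `Commute A spinZ`); #232's `GSWindowNode` stability rows and #237's
`gsObsNode_twStability` carry the same two hypotheses, so #237 lists the spin-flip E2 blocks
(`K+-`, `K-+` of l2-idea-1's `runs/idea1-toyV1-eom2x3/`) as NOT covered.

For the ground-state class actually used by `GSObsNode` — sector ground states with `S^z = 0` and an EVEN particle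
number `rectN n L = 2⌊n L²/2⌋` — the `S^z` hypothesis is unnecessary: the Hubbard Hamiltonian is `SU(2)` invariant,
so the `S^z = 0` sector energy IS the `N`-particle ground-state energy (`groundEnergyAt_eq_minEnergyOn_szSector`,
Lieb 1989, proof of Thm 1: "all competitors have a representative at `S^z = 0`"), i.e. an `S^z = 0` sector ground
state `ψ` is a ground state of `H_L` on the whole `N`-particle space; hence for EVERY operator `B` conserving the
particle number `⟨ψ, B⋆[H_L, B]ψ⟩ = ⟨Bψ, (H_L - E₀(N))Bψ⟩ ≥ 0`
(`star_dotProduct_conjTranspose_mul_commutator_mulVec_nonneg` on the `N`-particle subspace).  Averaging over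
translations and passing to the torus limit exactly as in the tree's proof gives:

* `localStability_of_szZero` — `ω(Ã⋆[H_{Λ⁺}, Ã]) ≥ 0` for every torus limit `ω` of `(2m_j, S^z = 0)`-sector ground
  states and EVERY `A ∈ 𝔄_Λ` with `Commute A totalNumber` (no `S^z` hypothesis): spin-flip words
  `c⋆_{x↑}c_{y↓}`, `S^±`-type strings, and any mixture of `S^z`-sectors are allowed;
* `gsObsNode_stability` — the un-relocated row for the `GSObsNode` interface of #232:
  `Commute A totalNumber → thicken Λ 1 ⊆ W → GSObsNode t U n W (stabilityObs' t U Λ A, embedded) 0`;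
* for #237: `gsObsNode_twStability` holds WITHOUT `hAS` — replace `hω.localStability t U hLs hgs hAN hAS` by
  `localStability_of_szZero t U hω hLs hgs hAN` in its proof (one line; the relocation argument is unchanged).

NOT covered (and genuinely false for canonical limits in general): words changing the particle number
(`[N, A] ≠ 0`, e.g. a single `c_{xσ}`): `⟨c ψ, (H - E₀(N)) c ψ⟩ ≥ (E₀(N-1) - E₀(N))‖cψ‖²` has no sign without a
chemical potential.

References: [cite: BratteliRobinsonII1997, Prop. 5.3.19 + Prop. 5.3.25]; [cite: LiebPRL1989, proof of Theorem 1];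
[cite: KullEtAl2024, §II.B] (E2 rows of ground-state relaxations).  Cell records: sr-mbsolver
`HOME/sr-mbsolver-op-07/lean/GSStabilityRowsSzZero.lean`; hubbard-alg `L2-cluster/INBOX.md` (audit line of 2026-08-22).
-/

noncomputable section

namespace Summit.Ventures.CertifiedManyBodySolver.HubbardAlg.GSStabilityRowsSzZero

open Matrix Finset _root_.Filter
open Literature.Probability.LatticeModels
open Literature.MathematicalPhysics.QuantumLattice
open Literature.MathematicalPhysics.QuantumLattice.HubbardWave0
open Literature.MathematicalPhysics.QuantumLattice.ThermodynamicLimit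
open Summit.Ventures.CertifiedManyBodySolver.HubbardAlg.GSWindowNodeD4
open scoped _root_.Topology ComplexOrder

/-! ## §1 Finite volume: an `S^z = 0` sector ground state is an `N`-particle ground state -/

section FiniteVolume

variable {Λ : Type*} [LinearOrder Λ] [Fintype Λ]

/-- An operator commuting with the particle number maps every `N`-particle sector into itself. [folklore] -/
theorem mulVec_mem_nParticleSubmodule_of_commute {B : Matrix (Finset (Orb Λ)) (Finset (Orb Λ)) ℂ}
    (hN : Commute B totalNumber) {N : ℕ} {v : Fock (Orb Λ)} (hv : v ∈ nParticleSubmodule N) :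
    B *ᵥ v ∈ nParticleSubmodule N := by
  rw [nParticleSubmodule_eq_eigenspace_holds N] at hv ⊢
  have hN' : Commute B (totalNumberOp : Matrix (Finset (Orb Λ)) (Finset (Orb Λ)) ℂ) := by
    rw [totalNumberOp_eq_totalNumber]; exact hN
  exact mulVec_mem_eigenspace_of_commute hN' hv

variable (G : SimpleGraph Λ) [DecidableRel G.Adj]

/-- **`SU(2)`: the `(2m, S^z = 0)` sector energy of the Hubbard Hamiltonian is its `2m`-particle ground-state
energy** (`minEnergyOn` over the whole `2m`-particle subspace), `m ≤ |Λ|`.  The tree's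
`groundEnergyAt_eq_minEnergyOn_szSector` restated on `nParticleSubmodule`. [cite: LiebPRL1989, proof of Theorem 1] -/
theorem minEnergyOn_nParticleSubmodule_eq_szSector_zero (t U : ℝ) {m : ℕ} (hm : m ≤ Fintype.card Λ) :
    (hamiltonian G t U).minEnergyOn (nParticleSubmodule (2 * m)) =
      (hamiltonian G t U).minEnergyOn (szSector (2 * m) 0) := by
  have h1 := groundEnergyAt_eq_minEnergyOn_szSector G t U hm
  rwa [groundEnergyAt, groundEnergy_eq_minEnergyOn _ _ (nParticleSubmodule (2 * m))
    (mem_nParticleSubmodule_iff (2 * m))] at h1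

/-- **An `S^z = 0` sector ground state is an `N`-particle ground state**: it lies in the `2m`-particle subspace and
its eigenvalue is the `2m`-particle ground-state energy. [cite: LiebPRL1989, proof of Theorem 1] -/
theorem isGroundStateInSector_szZero_nParticle (t U : ℝ) {m : ℕ} {φ : Fock (Orb Λ)}
    (hφ : IsGroundStateInSector (hamiltonian G t U) (2 * m) 0 φ) :
    φ ∈ nParticleSubmodule (2 * m) ∧ φ ≠ 0 ∧
      hamiltonian G t U *ᵥ φ =
        (((hamiltonian G t U).minEnergyOn (nParticleSubmodule (2 * m)) : ℝ) : ℂ) • φ := by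
  have hmem : φ ∈ szSector (m + m) (((m : ℝ) - m) / 2) := by
    rw [← szSector_two_mul_zero_eq]; exact hφ.1
  have hm : m ≤ Fintype.card Λ :=
    (le_card_of_isInSector ((mem_szSector_iff_isInSector m m φ).1 hmem) hφ.2.1).1
  refine ⟨(mem_nParticleSubmodule_iff _ _).2 ((mem_szSector_iff _ _ _).1 hφ.1).1, hφ.2.1, ?_⟩
  rw [minEnergyOn_nParticleSubmodule_eq_szSector_zero G t U hm]
  exact hφ.2.2

/-- **The ground-state inequality for every number-conserving perturbation** (finite volume, abstract form): for
an `S^z = 0` sector ground state `φ` of the Hubbard Hamiltonian and every `B` commuting with the particle number,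
`⟨φ, B⋆(HB - BH)φ⟩ = ⟨Bφ, (H - E₀)Bφ⟩ ≥ 0`. [cite: BratteliRobinsonII1997, Prop. 5.3.19] -/
theorem star_dotProduct_commutator_nonneg_of_szZero (t U : ℝ) {m : ℕ} {φ : Fock (Orb Λ)}
    (hφ : IsGroundStateInSector (hamiltonian G t U) (2 * m) 0 φ)
    {B : Matrix (Finset (Orb Λ)) (Finset (Orb Λ)) ℂ} (hB : Commute B totalNumber) :
    0 ≤ star φ ⬝ᵥ ((Bᴴ * (hamiltonian G t U * B - B * hamiltonian G t U)) *ᵥ φ) := by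
  obtain ⟨hφN, -, hφE⟩ := isGroundStateInSector_szZero_nParticle G t U hφ
  exact star_dotProduct_conjTranspose_mul_commutator_mulVec_nonneg (LiebThm1.hamiltonian_isHermitian G t U)
    (nParticleSubmodule (2 * m)) (fun v hv => mulVec_mem_nParticleSubmodule_of_commute hB hv) hφN hφE

end FiniteVolume

/-! ## §2 Torus: the local stability observable, translation average, torus limit -/

section Torus

variable {d : ℕ} (L : ℕ) [NeZero L] (t U : ℝ)

/-- **Finite volume (torus).** In an `S^z = 0` sector ground state `φ` of `hubbardTorus d L t U` (sector
`(2m, 0)`), for every region `Λ` small in the torus and every local `A ∈ 𝔄_Λ` conserving the local particle number: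
`⟨φ, Γ(Ã⋆ [H_{thicken Λ 1}, Ã]) φ⟩ ≥ 0` — no `S^z` hypothesis on `A`.  Proof: the tree's
`expect_fermionEmbed_localStability_nonneg` with the invariant subspace `szSector N M` replaced by the
`N`-particle subspace, on which `φ` is a ground state by `SU(2)` (§1). [cite: BratteliRobinsonII1997, Prop. 5.3.19] -/
theorem expect_fermionEmbed_stability_nonneg_of_szZero {Λ : Finset (Site d)}
    (hInj : Set.InjOn (Torus.proj (d := d) L) ↑(thicken (thicken Λ 1) 1)) {m : ℕ}
    {φ : Fock (Orb (FermionTorus d L))} (hφ : IsGroundStateInSector (hubbardTorus d L t U) (2 * m) 0 φ)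
    {A : FermionOp Λ} (hAN : Commute A totalNumber) :
    0 ≤ expect (fermionEmbed (PolySite.toTorusEmb L (hInj.mono (by exact_mod_cast subset_thicken (thicken Λ 1) 1)))
        ((fermionEmbed (PolySite.incl (subset_thicken Λ 1)) A)ᴴ *
          ((hubbardFermionInteraction d t U).localHamiltonian (thicken Λ 1) *
              fermionEmbed (PolySite.incl (subset_thicken Λ 1)) A -
            fermionEmbed (PolySite.incl (subset_thicken Λ 1)) A *
              (hubbardFermionInteraction d t U).localHamiltonian (thicken Λ 1)))) φ := by
  have hclosed : ∀ x ∈ Λ, ∀ i : Fin d, x + unitVec i ∈ thicken Λ 1 ∧ x - unitVec i ∈ thicken Λ 1 :=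
    fun x hx i => ⟨add_unitVec_mem_thicken_one hx i, sub_unitVec_mem_thicken_one hx i⟩
  have hΛ : Set.InjOn (Torus.proj (d := d) L) ↑Λ :=
    hInj.mono (by exact_mod_cast (subset_thicken Λ 1).trans (subset_thicken (thicken Λ 1) 1))
  rw [Literature.MathematicalPhysics.QuantumLattice.expect, fermionEmbed_mul, fermionEmbed_conjTranspose,
    ← hubbardTorus_commutator_fermionEmbed L t U (subset_thicken Λ 1) hclosed hInj A]
  have hB : fermionEmbed (PolySite.toTorusEmb L (hInj.mono (by exact_mod_cast subset_thicken (thicken Λ 1) 1)))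
      (fermionEmbed (PolySite.incl (subset_thicken Λ 1)) A) = fermionEmbed (PolySite.toTorusEmb L hΛ) A := by
    rw [fermionEmbed_fermionEmbed]
    exact congrFun (congrArg DFunLike.coe (fermionEmbed_congr fun p => rfl)) A
  rw [hB]
  exact star_dotProduct_commutator_nonneg_of_szZero (fermionTorusGraph d L) t U hφ
    (commute_fermionEmbed_toTorusEmb_totalNumber L hΛ hAN)

/-- **Finite volume, translation average** (every translate of an `S^z = 0` sector ground state is one).
[cite: BratteliRobinsonII1997, Prop. 5.3.19] -/
theorem torusAvgExpectAt_stability_nonneg_of_szZero {Λ : Finset (Site d)}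
    (hInj : Set.InjOn (Torus.proj (d := d) L) ↑(thicken (thicken Λ 1) 1)) {m : ℕ}
    {ψ : Fock (Orb (FermionTorus d L))} (hψ : IsGroundStateInSector (hubbardTorus d L t U) (2 * m) 0 ψ)
    {A : FermionOp Λ} (hAN : Commute A totalNumber) :
    0 ≤ torusAvgExpectAt L (thicken Λ 1)
        ((fermionEmbed (PolySite.incl (subset_thicken Λ 1)) A)ᴴ *
          ((hubbardFermionInteraction d t U).localHamiltonian (thicken Λ 1) *
              fermionEmbed (PolySite.incl (subset_thicken Λ 1)) A -
            fermionEmbed (PolySite.incl (subset_thicken Λ 1)) A *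
              (hubbardFermionInteraction d t U).localHamiltonian (thicken Λ 1))) ψ := by
  have h₁ : Set.InjOn (Torus.proj (d := d) L) ↑(thicken Λ 1) :=
    hInj.mono (by exact_mod_cast subset_thicken (thicken Λ 1) 1)
  rw [torusAvgExpectAt_of_injOn L h₁]
  have hsum : (0 : ℂ) ≤ ∑ v : TorusSite d L, expect (fermionEmbed (PolySite.toTorusEmb L h₁)
      ((fermionEmbed (PolySite.incl (subset_thicken Λ 1)) A)ᴴ *
        ((hubbardFermionInteraction d t U).localHamiltonian (thicken Λ 1) *
            fermionEmbed (PolySite.incl (subset_thicken Λ 1)) A -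
          fermionEmbed (PolySite.incl (subset_thicken Λ 1)) A *
            (hubbardFermionInteraction d t U).localHamiltonian (thicken Λ 1))))
      ((fockTranslate v).val *ᵥ ψ) :=
    Finset.sum_nonneg fun v _ => expect_fermionEmbed_stability_nonneg_of_szZero L t U hInj
      (hψ.fockTranslate_mulVec v (relabel_translate_hubbardTorus v t U)) hAN
  obtain ⟨hre, him⟩ := Complex.nonneg_iff.1 hsum
  rw [show ((Fintype.card (TorusSite d L) : ℂ))⁻¹ = (((Fintype.card (TorusSite d L) : ℝ)⁻¹ : ℝ) : ℂ) by
    push_cast; rfl, Complex.nonneg_iff, Complex.re_ofReal_mul, Complex.im_ofReal_mul, ← him, mul_zero]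
  exact ⟨mul_nonneg (inv_nonneg.2 (Nat.cast_nonneg _)) hre, rfl⟩

variable {L}

/-- **Local stability of `S^z = 0` torus-limit ground states under EVERY gauge-invariant local perturbation.**
Let `ω` be a torus limit of the translation averages of `(2m_j, S^z = 0)`-sector ground states `ψ_{Ls j}` of
`hubbardTorus d (Ls j) t U`, `Ls → ∞`.  Then for every region `Λ` and every `A ∈ 𝔄_Λ` conserving the local
particle number (NO `S^z` hypothesis), `ω(Ã⋆ [H_{thicken Λ 1}, Ã]) ≥ 0`.  Bratteli–Robinson II Prop. 5.3.25 for
the gauge-invariant perturbations of an `SU(2)`-symmetric canonical ground state.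
[cite: BratteliRobinsonII1997, Prop. 5.3.25] -/
theorem localStability_of_szZero {ω : InfVolFermionState d}
    {ψ : ∀ L, Fock (Orb (FermionTorus d L))} {Ls : ℕ → ℕ} (h : ω.IsTorusLimitOf ψ Ls)
    (hLs : Tendsto Ls atTop atTop) {m : ℕ → ℕ}
    (hgs : ∀ j, IsGroundStateInSector (hubbardTorus d (Ls j) t U) (2 * m j) 0 (ψ (Ls j)))
    {Λ : Finset (Site d)} {A : FermionOp Λ} (hAN : Commute A totalNumber) :
    0 ≤ ω.expect (thicken Λ 1)
        ((fermionEmbed (PolySite.incl (subset_thicken Λ 1)) A)ᴴ *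
          ((hubbardFermionInteraction d t U).localHamiltonian (thicken Λ 1) *
              fermionEmbed (PolySite.incl (subset_thicken Λ 1)) A -
            fermionEmbed (PolySite.incl (subset_thicken Λ 1)) A *
              (hubbardFermionInteraction d t U).localHamiltonian (thicken Λ 1))) := by
  refine ge_of_tendsto (h (thicken Λ 1) _) ?_
  filter_upwards [eventually_injOn_proj_of_tendsto (thicken (thicken Λ 1) 1) hLs, hLs.eventually_ge_atTop 1]
    with j hInj hj
  haveI : NeZero (Ls j) := ⟨by omega⟩
  rw [torusAvgExpect_eq]
  exact torusAvgExpectAt_stability_nonneg_of_szZero (Ls j) t U hInj (hgs j) hAN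

end Torus

/-! ## §3 Rows for the `GSObsNode` interface of #232 (`GSWindowNodeD4`) -/

/-- **E2-type ground-state row for every number-conserving word** (un-relocated form): for `A ∈ 𝔄_Λ` with
`Commute A totalNumber` and `thicken Λ 1 ⊆ W`, the embedded stability observable `stabilityObs' t U Λ A` is a
`GSObsNode t U n W · 0` — the class of `GSObsNode` consists of `(rectN n L = 2⌊n L²/2⌋, S^z = 0)`-sector ground
states, so `localStability_of_szZero` applies.  (The relocated / term-wise version is #237's `gsObsNode_twStability`
with its `hAS` hypothesis deleted, by the same substitution.) [cite: BratteliRobinsonII1997, Prop. 5.3.25] -/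
theorem gsObsNode_stability (t U n : ℝ) {W Λ : Finset (Site 2)} (hΛ : thicken Λ 1 ⊆ W) {A : FermionOp Λ}
    (hAN : Commute A totalNumber) :
    GSObsNode t U n W (fermionEmbed (PolySite.incl hΛ) (stabilityObs' t U Λ A)) 0 := by
  intro ω ψ Ls hLs hω _ _ _ hgs _ _
  rw [ω.compatible hΛ]
  exact (Complex.nonneg_iff.1
    (localStability_of_szZero t U hω hLs (m := fun j => ⌊n * ((Ls j : ℕ) : ℝ) ^ 2 / 2⌋₊) hgs hAN)).1

/-- The same row with a non-negative certificate weight `y ≥ 0` (dual multiplier of an E2 row / of one rank-one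
piece `λ_k w_k w_k⋆` of a PSD block multiplier). [cite: KullEtAl2024, §II.B] -/
theorem gsObsNode_smul_stability (t U n : ℝ) {W Λ : Finset (Site 2)} (hΛ : thicken Λ 1 ⊆ W) {A : FermionOp Λ}
    (hAN : Commute A totalNumber) {y : ℝ} (hy : 0 ≤ y) :
    GSObsNode t U n W ((y : ℂ) • fermionEmbed (PolySite.incl hΛ) (stabilityObs' t U Λ A)) 0 := by
  intro ω ψ Ls hLs hω a b c hgs e f
  have k := gsObsNode_stability t U n hΛ hAN ω ψ Ls hLs hω a b c hgs e f
  rw [map_smul, smul_eq_mul, Complex.re_ofReal_mul]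
  exact mul_nonneg hy k

end Summit.Ventures.CertifiedManyBodySolver.HubbardAlg.GSStabilityRowsSzZero

end
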